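import Summits.QuantumFields.BalabanUV.Beta.BorderedHessianResidualDressing
import Summits.QuantumFields.BalabanUV.Beta.BorderedHessianBlind

/-!
# RULES 3–4 OF THE RELATIVE INVERSE AT `j = 0`: the block-mean co-dressed one-step resolvent inverts the undressed bordered Hessian on
# the range of the coarse axial coordinate projector — `RelInv (Π̂_bm KInv Π̂_bmᵀ) (bhK) (axEc)` (β sub-cell, row BETA-an2, gen 13)

HONEST FRAMING (cell charter, verbatim): «discharging BetaPertH makes Balaban's UV stability UNCONDITIONAL — a real
constructive-QFT result; it is NOT the continuum limit and NOT the Clay problem.»  DERIVED cell leaf (pub-balaban β sub-cell, lane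
an2 gen 13); no statement of Bałaban's papers is typed here, no `[cite:]` tag, no `Prop` fact; it DISCHARGES, at `j = 0` and for the
REPAIRED projector `axEc`, the binders h3/h4 of the `hR` chain of the block-mean-dressed spine — nothing else of the β-function wall.
NOT `BetaPertH`; NOT continuum; NOT Clay.

## What is here
* §1 LETTERS OF THE ROOTED AXIAL CONTOUR ARE COMB BONDS (`mem_axialAux_coords`, `isCombBondAt_of_mem_axial`); hence an indicator 1-form
  on a NON-comb bond is in the rooted axial gauge (`axialGaugeAt_delta1_of_not_isCombBond`) and is FIXED by `Π_bm`
  (`pmBm_of_not_isCombBond : pmBm ρ N β p α x = [β = α ∧ p = x]`);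
* §2 `comp_axEc_piKBmC : axEc ∘ piKBmC = axEc` and `comp_trK_piKBmC_axEc : (piKBmC)ᵀ ∘ axEc = axEc`;
* §3 **THE RULES** for `G := coDressKBmAt (toSite r) N (KInv N)`, `𝕄 := bhK N`, `E := axEc (toSite r) N` (every in-block root, `N ≥ 1`):
  `rule4_KInv : (E ∘ 𝕄) ∘ G = E` — assembled from `bhK ∘ Π̂ = bhK` (`BorderedHessianBlind`), `bhK ∘ KInv = resid`
  (`BorderedHessianResidual`), `resid ∘ Π̂ᵀ = piKBmC` (`BorderedHessianResidualDressing`) and §2 — and `rule3_KInv : (G ∘ 𝕄) ∘ E = E` (the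
  transposed chain); with rules 1–2 (`AxialCoordinateProjectorCoarseRules`): **`relInv_coDressKBmAt_KInv`**;
* §4 AT `j = 0` OF THE STEP FAMILY: `KInvStep_zero_eq : KInvStep Lc 0 = KInv Lc` and
  **`relInv_coDressKBmAt_KInvStep_zero : RelInv (coDressKBmAt (toSite r) Lc (KInvStep Lc 0)) (bhK Lc) (axEc (toSite r) Lc)`** — the
  `j = 0` instance, with `𝕄₀ := bhK Lc`, of the sockets h3/h4 of `SpineRooted.axisReflectionCovariant_flipK_TbalOf_JsBalBmAtOf_ctrC`
  (the wiring re-issued over `axEc`; the gen-12 wiring over `axE` is vacuous, `AxialCoordinateProjectorCoarse` §2).  `j ≥ 1` stays a binder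
  (supplier: the step-`j` effective bordered Hessian as a spread kernel).

All declarations `[folklore]`; axioms standard.  Provenance: b2b-balaban β sub-cell, unit beta-an2 gen 13, 2026-08-20 (v1); over the six
gen-13 leaves above, `HessianTelescopingKKT.kInvStep_zero`, `RootedComb`, `AxialProjectorBlockMean`, `AxialDressingRootedSupport` BY NAME.
-/

open Finset
open scoped BigOperators
open Literature.Probability.LatticeModels (TorusSite Torus.proj Torus.proj_apply)
open Literature.MathematicalPhysics.QuantumFieldTheory
open Literature.MathematicalPhysics.QuantumFieldTheory.Balaban1983to89
open Literature.MathematicalPhysics.QuantumFieldTheory.Balaban1983to89.Beta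
open B12Sec2to5 (l1 l1_nonneg)
open ExpKernelCalculus (MKer Decays BiLoc comp tr shiftK)
open AffineAveraging (Form0 Form1 Form2 box toSite unitVec unitVec_apply dz curv curvAdj codiff₁ contourSum)
open AveragingContours (blk corner seg axialAux axial blk_block)
open AveragingContoursRooted (AxialGaugeAt)
open KKTFluctuationKernel (delta1 delta1_apply)
open OneStepResolventKernel (Fib KInv)
open OneStepKernelFamily (KInvStep dec decays_KInvStep)
open Summit.QuantumFields.BalabanUV.Beta.TameKernelCalculus
open Summit.QuantumFields.BalabanUV.Beta.ChartConjugationRelative (RelInv)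
open Summit.QuantumFields.BalabanUV.Beta.AxialDressingRooted (cube mem_cube zero_mem_cube bondInd bondInd_apply pmBm piKBm piKBm_inl_inl
  piKBm_inl_inr piKBm_inr_inl piKBm_inr_inr spr_piKBm spr_trK_piKBm coDressKBmAt coDressKBmAt_eq spr_coDressKBmAt IsCombBondAt mem_seg_site
  axEc axEc_inl_inl axEc_inl_inr axEc_inr_inl axEc_inr_inr spr_axEc trK_axEc comp_axEc_apply piKBmC piKBmC_inl_inl piKBmC_inl_inr
  piKBmC_inr_inl piKBmC_inr_inr comp_axEc_coDressKBmAt comp_coDressKBmAt_axEc KInv_inr_right_off spr_comp)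
open Summit.QuantumFields.BalabanUV.Beta.AxialProjectorBlockMean (axProjBmAt axProjBmAt_eq_self_of_axialGaugeAt)

namespace Summit.QuantumFields.BalabanUV.Beta.BorderedHessian

noncomputable section

/-! ## §1 Letters of the rooted axial contour are comb bonds; `Π_bm` fixes the indicators of non-comb bonds -/

section Comb

variable {n : ℕ} {R : Type*} [AddCommGroup R]

/-- [folklore] **LETTERS OF THE PARTIAL AXIAL CONTOURS WITH EXACT OFF-AXIS COORDINATES**: a letter of `axialAux A y x m` is `±A_κ(z′)`
with `κ < m`, `z′_j = x_j` for `j > κ`, `z′_j = y_j` for `j < κ`, and the bond `[z′_κ, z′_κ + 1]` inside `[min(y_κ,x_κ), max(y_κ,x_κ)]`. -/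
theorem mem_axialAux_coords {A : Form1 n R} {y x : Fin n → ℤ} {a : R} :
    ∀ {m : ℕ}, a ∈ axialAux A y x m →
      ∃ (κ : Fin n) (z' : Fin n → ℤ), (a = A κ z' ∨ a = -A κ z') ∧ (κ : ℕ) < m ∧
        (∀ j : Fin n, j ≠ κ → z' j = if (κ : ℕ) < (j : ℕ) then x j else y j) ∧
        min (y κ) (x κ) ≤ z' κ ∧ z' κ + 1 ≤ max (y κ) (x κ)
  | 0, h => by simp [axialAux] at h
  | m + 1, h => by
    simp only [axialAux, List.mem_append] at h
    rcases h with h | h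
    · split_ifs at h with hm
      · obtain ⟨z', e, hoff, hlo, hhi⟩ := mem_seg_site h
        have hκ : (corner y x (m + 1)) ⟨m, hm⟩ = y ⟨m, hm⟩ := by simp [corner]
        rw [hκ, add_sub_cancel] at hlo hhi
        refine ⟨⟨m, hm⟩, z', e, Nat.lt_succ_self m, fun j hj => ?_, hlo, hhi⟩
        rw [hoff j hj]
        simp only [corner]
        have hjm : (j : ℕ) ≠ m := fun e => hj (Fin.ext e)
        by_cases h1 : m + 1 ≤ (j : ℕ)
        · rw [if_pos h1, if_pos (show m < (j : ℕ) by omega)]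
        · rw [if_neg h1, if_neg (show ¬ m < (j : ℕ) by omega)]
      · simp at h
    · obtain ⟨κ, z', e, hκ, hrest⟩ := mem_axialAux_coords h
      exact ⟨κ, z', e, Nat.lt_succ_of_lt hκ, hrest⟩

omit [AddCommGroup R] in
/-- [folklore] A site with all coordinates in the block of `y` has block index `y`. -/
theorem blk_eq_of_bounds {N : ℕ} (hN : 1 ≤ N) {z y : Fin n → ℤ} (h : ∀ j, (N : ℤ) * y j ≤ z j ∧ z j < (N : ℤ) * y j + N) : blk N z = y := by
  funext j
  obtain ⟨h1, h2⟩ := h j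
  show z j / (N : ℤ) = y j
  have hN' : (0 : ℤ) < N := by exact_mod_cast hN
  have e : z j = (z j - N * y j) + y j * N := by ring
  rw [e, Int.add_mul_ediv_right _ _ hN'.ne', Int.ediv_eq_zero_of_lt (by linarith) (by linarith), zero_add]

/-- [folklore] **EVERY LETTER OF THE ROOTED AXIAL CONTOUR INSIDE A BLOCK IS THE VALUE ON A COMB BOND** (in-block root `r`, block point `b`). -/
theorem isCombBondAt_of_mem_axial {N : ℕ} (hN : 1 ≤ N) {r b : Fin n → ℕ} (hr : r ∈ box n N) (hb : b ∈ box n N) (y : Fin n → ℤ)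
    {A : Form1 n R} {a : R} (h : a ∈ axial A ((N : ℤ) • y + toSite r) ((N : ℤ) • y + toSite b)) :
    ∃ (κ : Fin n) (z' : Fin n → ℤ), (a = A κ z' ∨ a = -A κ z') ∧ IsCombBondAt (toSite r) N κ z' := by
  obtain ⟨κ, z', e, -, hoff, hlo, hhi⟩ := mem_axialAux_coords h
  have hrj : ∀ j, ((r j : ℕ) : ℤ) < N := fun j => by exact_mod_cast Finset.mem_range.1 (Fintype.mem_piFinset.1 hr j)
  have hbj : ∀ j, ((b j : ℕ) : ℤ) < N := fun j => by exact_mod_cast Finset.mem_range.1 (Fintype.mem_piFinset.1 hb j)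
  simp only [Pi.add_apply, Pi.smul_apply, smul_eq_mul, toSite] at hoff hlo hhi
  -- coordinate bounds of `z'` and `z' + e_κ`
  have hzb : ∀ j, (N : ℤ) * y j ≤ z' j ∧ z' j < (N : ℤ) * y j + N := by
    intro j
    by_cases hj : j = κ
    · subst hj
      have h0r : (0 : ℤ) ≤ (r j : ℕ) := by positivity
      have h0b : (0 : ℤ) ≤ (b j : ℕ) := by positivity
      constructor
      · exact le_trans (le_min (by linarith) (by linarith)) hlo
      · have := max_le (a := (N : ℤ) * y j + (r j : ℕ)) (b := (N : ℤ) * y j + (b j : ℕ)) (c := (N : ℤ) * y j + N - 1)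
          (by linarith [hrj j]) (by linarith [hbj j])
        linarith
    · rw [hoff j hj]
      have h0r : (0 : ℤ) ≤ (r j : ℕ) := by positivity
      have h0b : (0 : ℤ) ≤ (b j : ℕ) := by positivity
      split_ifs
      · exact ⟨by linarith, by linarith [hbj j]⟩
      · exact ⟨by linarith, by linarith [hrj j]⟩
  have hzb' : ∀ j, (N : ℤ) * y j ≤ (z' + unitVec κ) j ∧ (z' + unitVec κ) j < (N : ℤ) * y j + N := by
    intro j
    simp only [Pi.add_apply, unitVec_apply]
    by_cases hj : j = κ
    · subst hj
      rw [if_pos rfl]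
      have h0r : (0 : ℤ) ≤ (r j : ℕ) := by positivity
      constructor
      · linarith [(hzb j).1]
      · have := max_le (a := (N : ℤ) * y j + (r j : ℕ)) (b := (N : ℤ) * y j + (b j : ℕ)) (c := (N : ℤ) * y j + N - 1)
          (by linarith [hrj j]) (by linarith [hbj j])
        linarith
    · rw [if_neg hj, add_zero]; exact hzb j
  have hblk : blk N z' = y := blk_eq_of_bounds hN hzb
  have hblk' : blk N (z' + unitVec κ) = y := blk_eq_of_bounds hN hzb'
  refine ⟨κ, z', e, fun j hj => ?_, by rw [hblk, hblk']⟩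
  have hjκ : j ≠ κ := fun e => by rw [e] at hj; exact lt_irrefl _ hj
  have hlt : ¬ (κ : ℕ) < (j : ℕ) := fun h' => lt_asymm (Fin.lt_def.1 hj) h'
  rw [hoff j hjκ, if_neg hlt, hblk]
  simp only [Pi.smul_apply, smul_eq_mul, toSite]

/-- [folklore] **THE INDICATOR OF A NON-COMB BOND IS IN THE ROOTED AXIAL GAUGE** (in-block root). -/
theorem axialGaugeAt_delta1_of_not_isCombBond {d N : ℕ} (hN : 1 ≤ N) {r : Fin (d + 1) → ℕ} (hr : r ∈ box (d + 1) N) {α : Fin (d + 1)}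
    {x : Fin (d + 1) → ℤ} (hc : ¬ IsCombBondAt (toSite r) N α x) : AxialGaugeAt (toSite r) (delta1 α x) N := by
  intro y b hb
  refine List.sum_eq_zero fun a ha => ?_
  obtain ⟨κ, z', e, hcomb⟩ := isCombBondAt_of_mem_axial hN hr hb y ha
  have h0 : delta1 α x κ z' = 0 := by
    rw [delta1_apply, if_neg]
    rintro ⟨rfl, rfl⟩
    exact hc hcomb
  rcases e with e | e
  · rw [e, h0]
  · rw [e, h0, neg_zero]

/-- [folklore] **`Π_bm` FIXES THE INDICATOR OF A NON-COMB BOND**: `pmBm ρ N β p α x = [β = α ∧ p = x]` (in-block root). -/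
theorem pmBm_of_not_isCombBond {d N : ℕ} (hN : 1 ≤ N) {r : Fin (d + 1) → ℕ} (hr : r ∈ box (d + 1) N) {α : Fin (d + 1)}
    {x : Fin (d + 1) → ℤ} (hc : ¬ IsCombBondAt (toSite r) N α x) (β : Fin (d + 1)) (p : Fin (d + 1) → ℤ) :
    pmBm (toSite r) N β p α x = if β = α ∧ p = x then 1 else 0 := by
  have hreal : (fun κ z => (bondInd α x κ z : ℝ)) = delta1 α x := by
    funext κ z; rw [bondInd_apply, delta1_apply]; split_ifs <;> simp
  unfold AxialDressingRooted.pmBm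
  rw [hreal, axProjBmAt_eq_self_of_axialGaugeAt hN (axialGaugeAt_delta1_of_not_isCombBond hN hr hc), delta1_apply]

end Comb

/-! ## §2 `axEc ∘ piKBmC = axEc` -/

section Proj

variable {d : ℕ}

open Classical in
/-- [folklore] **`axEc ∘ piKBmC = axEc`**: on the non-comb rows `Π_bm` acts as the identity (§1), comb rows and non-coarse multiplier rows are
killed on both sides (in-block root). -/
theorem comp_axEc_piKBmC {N : ℕ} (hN : 1 ≤ N) {r : Fin (d + 1) → ℕ} (hr : r ∈ box (d + 1) N) :
    comp (axEc (toSite r) N) (piKBmC (toSite r) N) = axEc (d := d) (toSite r) N := by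
  funext x x' a b
  rw [comp_axEc_apply]
  rcases a with α | m
  · dsimp only
    rcases b with β | m'
    · rw [piKBmC_inl_inl, piKBm_inl_inl, axEc_inl_inl]
      by_cases hc : IsCombBondAt (toSite r) N α x
      · rw [if_pos hc, if_neg (fun h => h.2.2 hc)]
      · rw [if_neg hc, pmBm_of_not_isCombBond hN hr hc]
        by_cases hx : x = x' ∧ α = β
        · obtain ⟨rfl, rfl⟩ := hx
          rw [sub_self, if_pos (zero_mem_cube N), if_pos ⟨rfl, rfl⟩, if_pos ⟨rfl, rfl, hc⟩]
        · have hR : ¬ (x = x' ∧ α = β ∧ ¬ IsCombBondAt (toSite r) N α x) := fun h => hx ⟨h.1, h.2.1⟩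
          have hL : ¬ (β = α ∧ x' = x) := fun h => hx ⟨h.2.symm, h.1.symm⟩
          rw [if_neg hR, if_neg hL, ite_self]
    · rw [piKBmC_inl_inr, axEc_inl_inr, ite_self]
  · dsimp only
    rcases b with β | m'
    · rw [piKBmC_inr_inl, axEc_inr_inl, ite_self]
    · rw [piKBmC_inr_inr, axEc_inr_inr]
      by_cases hx : Torus.proj N x = 0
      · rw [if_pos hx]
      · rw [if_neg hx, if_neg (fun h => hx h.2.2)]

/-- [folklore] `(piKBmC)ᵀ ∘ axEc = axEc` (transpose of `comp_axEc_piKBmC`, `axEc` symmetric). -/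
theorem comp_trK_piKBmC_axEc {N : ℕ} (hN : 1 ≤ N) {r : Fin (d + 1) → ℕ} (hr : r ∈ box (d + 1) N) :
    comp (trK (piKBmC (toSite r) N)) (axEc (toSite r) N) = axEc (d := d) (toSite r) N := by
  conv_lhs => rw [← trK_axEc (toSite r) N]
  rw [← trK_comp, comp_axEc_piKBmC hN hr, trK_axEc]

end Proj

/-! ## §3 Rules 3–4 for the co-dressed one-step resolvent against the undressed bordered Hessian -/

section Rules

variable {d : ℕ} {N : ℕ} [NeZero N] {r : Fin (d + 1) → ℕ}

/-- [folklore] The packed resolvent is spread. -/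
theorem spr_KInv : Spr (KInv (N := N) (d := d)) := by
  obtain ⟨δ, C, hδ, -, h⟩ := OneStepResolventKernel.decays_KInv (N := N) (d := d)
  exact ⟨C, δ, hδ, h⟩

/-- [folklore] `bhK N ∘ G = piKBmC` for `G := Π̂_bm KInv Π̂_bmᵀ`: blindness, residual, and the dressing of the residual. -/
theorem comp_bhK_coDressKBmAt_KInv (hr : r ∈ box (d + 1) N) :
    comp (bhK N) (coDressKBmAt (toSite r) N (KInv (N := N))) = piKBmC (d := d) (toSite r) N := by
  have hN : 1 ≤ N := Nat.one_le_iff_ne_zero.mpr (NeZero.ne N)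
  have sM : Spr (bhK (d := d) N) := spr_bhK hN
  have sP : Spr (piKBm (d := d) (toSite r) N) := spr_piKBm hN hr
  have sPt : Spr (trK (piKBm (d := d) (toSite r) N)) := spr_trK_piKBm hN hr
  have sK : Spr (KInv (N := N) (d := d)) := spr_KInv
  rw [coDressKBmAt_eq, comp_assoc_tame sM.tame (spr_comp sPt sK).tame sP.tame, comp_assoc_tame sM.tame sPt.tame sK.tame,
    comp_bhK_trK_piKBm hr, comp_bhK_KInv, comp_resid_piKBm N hr]

/-- [folklore] **RULE 4**: `(axEc ∘ bhK N) ∘ G = axEc` for `G := coDressKBmAt (toSite r) N (KInv N)`. -/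
theorem rule4_KInv (hr : r ∈ box (d + 1) N) :
    comp (comp (axEc (toSite r) N) (bhK N)) (coDressKBmAt (toSite r) N (KInv (N := N))) = axEc (d := d) (toSite r) N := by
  have hN : 1 ≤ N := Nat.one_le_iff_ne_zero.mpr (NeZero.ne N)
  have sE : Spr (axEc (d := d) (toSite r) N) := spr_axEc _ _
  have sM : Spr (bhK (d := d) N) := spr_bhK hN
  have sG : Spr (coDressKBmAt (toSite r) N (KInv (N := N) (d := d))) := spr_coDressKBmAt hN hr spr_KInv
  rw [← comp_assoc_tame sE.tame sM.tame sG.tame, comp_bhK_coDressKBmAt_KInv hr, comp_axEc_piKBmC hN hr]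

/-- [folklore] `G ∘ bhK N = (piKBmC)ᵀ`: the transposed chain (left blindness, left residual, transposed dressing of the residual). -/
theorem comp_coDressKBmAt_KInv_bhK (hr : r ∈ box (d + 1) N) :
    comp (coDressKBmAt (toSite r) N (KInv (N := N))) (bhK N) = trK (piKBmC (d := d) (toSite r) N) := by
  have hN : 1 ≤ N := Nat.one_le_iff_ne_zero.mpr (NeZero.ne N)
  have sM : Spr (bhK (d := d) N) := spr_bhK hN
  have sP : Spr (piKBm (d := d) (toSite r) N) := spr_piKBm hN hr
  have sPt : Spr (trK (piKBm (d := d) (toSite r) N)) := spr_trK_piKBm hN hr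
  have sK : Spr (KInv (N := N) (d := d)) := spr_KInv
  rw [coDressKBmAt_eq, ← comp_assoc_tame (spr_comp sPt sK).tame sP.tame sM.tame, comp_piKBm_bhK hr,
    ← comp_assoc_tame sPt.tame sK.tame sM.tame, comp_KInv_bhK, comp_trK_piKBm_trK_resid N hr]

/-- [folklore] **RULE 3**: `(G ∘ bhK N) ∘ axEc = axEc`. -/
theorem rule3_KInv (hr : r ∈ box (d + 1) N) :
    comp (comp (coDressKBmAt (toSite r) N (KInv (N := N))) (bhK N)) (axEc (toSite r) N) = axEc (d := d) (toSite r) N := by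
  have hN : 1 ≤ N := Nat.one_le_iff_ne_zero.mpr (NeZero.ne N)
  rw [comp_coDressKBmAt_KInv_bhK hr, comp_trK_piKBmC_axEc hN hr]

/-- [folklore] **THE RELATIVE INVERSE AT THE ONE-STEP LEVEL**: the block-mean co-dressed resolvent `G := Π̂_bm (KInv N) Π̂_bmᵀ` and the
undressed bordered Hessian `bhK N` satisfy all four rules of `RelInv G (bhK N) (axEc (toSite r) N)` (every in-block root, `N ≥ 1`). -/
theorem relInv_coDressKBmAt_KInv (hr : r ∈ box (d + 1) N) :
    RelInv (coDressKBmAt (toSite r) N (KInv (N := N) (d := d))) (bhK N) (axEc (toSite r) N) := by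
  have hN : 1 ≤ N := Nat.one_le_iff_ne_zero.mpr (NeZero.ne N)
  have h1 : comp (axEc (toSite r) N) (coDressKBmAt (toSite r) N (KInv (N := N) (d := d))) = coDressKBmAt (toSite r) N (KInv (N := N)) :=
    comp_axEc_coDressKBmAt hN hr (spr_KInv (N := N) (d := d)) (fun x hx z m b => OneStepResolventKernel.KInv_inr_off hx m b z)
  have h2 : comp (coDressKBmAt (toSite r) N (KInv (N := N) (d := d))) (axEc (toSite r) N) = coDressKBmAt (toSite r) N (KInv (N := N)) :=
    comp_coDressKBmAt_axEc hN hr (spr_KInv (N := N) (d := d)) (fun z hz x a m => KInv_inr_right_off hz x a m)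
  exact ⟨h1, h2, rule3_KInv hr, rule4_KInv hr⟩

end Rules

/-! ## §4 The `j = 0` instance of the step family -/

section StepZero

variable {d : ℕ} {Lc : ℕ} [NeZero Lc]

/-- [folklore] Packed resolvents with equal blocking factors are equal (the `NeZero` instance is a proposition). -/
theorem KInv_congr {M M' : ℕ} [NeZero M] [NeZero M'] (h : M = M') : KInv (N := M) (d := d) = KInv (N := M') := by
  subst h; rfl

/-- [folklore] **`KInvStep Lc 0 = KInv Lc`**: the undecimated first step (`HessianTelescopingKKT.kInvStep_zero` + `Lc ^ 1 = Lc`). -/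
theorem KInvStep_zero_eq : KInvStep (d := d) Lc 0 = KInv (N := Lc) := by
  rw [HessianTelescopingKKT.kInvStep_zero]
  exact KInv_congr (pow_one Lc)

variable {r : Fin (d + 1) → ℕ}

/-- [folklore] **RULE 4 AT `j = 0`**: `(axEc ∘ bhK Lc) ∘ G₀ = axEc`, `G₀ := coDressKBmAt (toSite r) Lc (KInvStep Lc 0)` — the socket h4 of the
coarse wiring `SpineRooted.axisReflectionCovariant_flipK_TbalOf_JsBalBmAtOf_ctrC` at `j = 0` with `M 0 := bhK Lc`. -/
theorem rule4_KInvStep_zero (hr : r ∈ box (d + 1) Lc) :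
    comp (comp (axEc (toSite r) Lc) (bhK Lc)) (coDressKBmAt (toSite r) Lc (KInvStep (d := d) Lc 0)) = axEc (toSite r) Lc := by
  rw [KInvStep_zero_eq]; exact rule4_KInv hr

/-- [folklore] **RULE 3 AT `j = 0`**: `(G₀ ∘ bhK Lc) ∘ axEc = axEc` — the socket h3 at `j = 0` with `M 0 := bhK Lc`. -/
theorem rule3_KInvStep_zero (hr : r ∈ box (d + 1) Lc) :
    comp (comp (coDressKBmAt (toSite r) Lc (KInvStep (d := d) Lc 0)) (bhK Lc)) (axEc (toSite r) Lc) = axEc (toSite r) Lc := by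
  rw [KInvStep_zero_eq]; exact rule3_KInv hr

/-- [folklore] **`RelInv G₀ (bhK Lc) (axEc (toSite r) Lc)`** for `G₀ := coDressKBmAt (toSite r) Lc (KInvStep Lc 0)`: the located item (ii-1)
of NOTE X-an2-41 §4 at `j = 0`, for the repaired coordinate projector, with the undressed bordered Hessian as `𝕄₀`. -/
theorem relInv_coDressKBmAt_KInvStep_zero (hr : r ∈ box (d + 1) Lc) :
    RelInv (coDressKBmAt (toSite r) Lc (KInvStep (d := d) Lc 0)) (bhK Lc) (axEc (toSite r) Lc) := by
  rw [KInvStep_zero_eq]; exact relInv_coDressKBmAt_KInv hr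

end StepZero

end

end Summit.QuantumFields.BalabanUV.Beta.BorderedHessian
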